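import Mathlib.RingTheory.Polynomial.Basic
import Mathlib.RingTheory.PrincipalIdealDomain
import Mathlib.LinearAlgebra.Dimension.Constructions
import Mathlib.LinearAlgebra.Dimension.Finrank
import Literature.NumberTheory.DiophantineGeometry.FunctionFieldGenus
import Literature.NumberTheory.DiophantineGeometry.RatFuncPlaces
import HarnessLib

/-!
# The rational function field has genus zero (Stichtenoth Example 1.4.18)

Sibling proof file of `Literature.NumberTheory.DiophantineGeometry.FunctionFieldGenus` (D-0014
append protocol: the statement file stays a definitions/named-facts file). It discharges the
named fact

* `Literature.AlgFunctionField.genus_ratFunc : ∀ K [Field K], genus K (RatFunc K) = 0`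

by `Literature.NumberTheory.DiophantineGeometry.AlgFunctionField.genus_ratFunc_holds`, and on the way proves Riemann–Roch for `K(X)`:
`ell_ratFunc : ℓ(D) = max (0, deg D + 1)` for every divisor `D` of `K(X)/K`, `K` any field.

## Source

H. Stichtenoth, *Algebraic Function Fields and Codes*, 2nd ed., GTM 254 (2009), §1.4
(Def. 1.4.4 `ℒ(A)`, Def. 1.4.15 genus `g := max {deg A - ℓ(A) + 1 | A ∈ Div(F)}`,
Example 1.4.13 principal divisors in `K(x)`, Example 1.4.18 "the rational function field
`K(x)/K` has genus `g = 0`"), read in the held copy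
`book:stichtenothnd-algebraic-function-fields-codes` (pdf pp. 26–29); the places of `K(x)`
(§1.2, Prop. 1.2.1 and Thm. 1.2.2, pdf pp. 19–21) are in
`Literature.NumberTheory.DiophantineGeometry.RatFuncPlaces` (`P_∞ = ratFuncInftyPlace K`, the
classification `ratFuncPlaceEquiv`, degrees) and
`Literature.NumberTheory.DiophantineGeometry.FunctionFieldGenusRatPlacesProofs`
(`P_{p(x)} = PlaceOver.ofPrime K (RatFunc K) p`).

The fact is stated faithfully: `genus K F = sSup {g : ℕ | ∃ D, g = deg D + 1 - ℓ(D)}` is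
Stichtenoth's Def. 1.4.15 (the vendored docstring's "Ex. I.4.18" is the first-edition number of
Example 1.4.18); it is not weakened here.

## Proof

Stichtenoth's three-line argument for Example 1.4.18 (`1, x, …, x^r ∈ ℒ(r P_∞)`, hence
`r + 1 ≤ ℓ(r P_∞) = r + 1 - g` for `r ≫ 0` by Riemann's theorem 1.4.17 (b), so `g ≤ 0`) rests
on Riemann's theorem (Prop. 1.4.14 / Thm. 1.4.17), which `FunctionFieldGenus` only records as
the named facts `bddAbove_genusSet` / `degree_add_one_sub_ell_le_genus`. We therefore prove the
genus-zero Riemann–Roch formula for `K(X)` directly, which is elementary once the places are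
known (this is the computation behind Example 1.4.13, eq. (1.20)):

1. (`Divisor.exists_eq_single_add_mapDomain`) by Thm. 1.2.2 every divisor is
   `D = n • P_∞ + Σ_p E(p) • P_{p(x)}` (`p` over the monic irreducibles = nonzero primes of
   `K[X]`), and `deg D = n + Σ_p E(p) deg p` by Prop. 1.2.1 (`degree_single_add_mapDomain`);
2. (`mem_riemannRochSpace_single_add_mapDomain_iff`) by Prop. 1.2.1 (prime elements `p(x)`
   and `1/x`), `z ∈ ℒ(D)` iff `v_∞(z) ≤ exp n` and `v_p(z) ≤ exp E(p)` for Mathlib's normalised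
   valuations `RatFunc.inftyValuation`, `HeightOneSpectrum.valuation`;
3. (`mem_riemannRochSpace_single_add_mapDomain_iff_exists_polynomial`) with the multiplier
   `f := ∏_p p(x)^{E(p)}` (`v_p(f) = exp (-E(p))`, `v_∞(f) = exp (Σ E(p) deg p)`), `z ∈ ℒ(D)`
   iff `v_p(f z) ≤ 1` for all `p` and `v_∞(f z) ≤ exp (deg D)`, i.e. iff `f z ∈ K[X]` (an
   element of `K(X)` integral at all finite places is a polynomial, Mathlib
   `IsDedekindDomain.HeightOneSpectrum.mem_integers_of_valuation_le_one`) of degree `≤ deg D`;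
4. (`ell_single_add_mapDomain`, `ell_ratFunc`) so `z ↦ f z` is a `K`-linear isomorphism
   `ℒ(D) ≃ K[X]_{deg ≤ deg D} = Polynomial.degreeLT K (deg D + 1)`, of dimension
   `max (0, deg D + 1)`;
5. (`genusSet_ratFunc`, `genus_ratFunc_holds`) hence `deg D + 1 - ℓ(D) ≤ 0` for all `D` with
   equality at `D = 0`, `genusSet K K(X) = {0}` and `genus = sSup {0} = 0`.

No new definitions; the multiplier is written out as a `Finsupp.prod` in the statements.

## References

* H. Stichtenoth, *Algebraic Function Fields and Codes*, 2nd ed., GTM 254, Springer 2009, §1.2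
  (Prop. 1.2.1, Thm. 1.2.2), §1.4 (Def. 1.4.4, Cor. 1.4.12, Example 1.4.13,
  Def. 1.4.15, Thm. 1.4.17, Example 1.4.18), §1.5 (Thm. 1.5.17). doi:10.1007/978-3-540-76878-4
-/

noncomputable section

namespace Literature.NumberTheory.DiophantineGeometry.AlgFunctionField

universe u

section RatFuncRiemannRoch

open IsDedekindDomain Polynomial WithZero Module Submodule.IsPrincipal

variable {K : Type u} [Field K]

/-! ### Divisors of `K(X)/K`: the part at infinity and the finite part -/

/-- Every divisor of `K(X)/K` is `n • P_∞ + Σ_p E(p) • P_{p(x)}` for an integer `n` and a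
finitely supported function `E` on the nonzero primes of `K[X]` (because `P_∞` and the `P_{p(x)}`
are all the places, Stichtenoth Thm. 1.2.2). [cite: Stichtenoth2009, Thm. 1.2.2] -/
theorem Divisor.exists_eq_single_add_mapDomain (D : Divisor K (RatFunc K)) :
    ∃ (n : ℤ) (E : HeightOneSpectrum K[X] →₀ ℤ),
      D = Finsupp.single (ratFuncInftyPlace K) n +
        E.mapDomain (PlaceOver.ofPrime K (RatFunc K)) := by
  refine ⟨D (ratFuncInftyPlace K),
    D.comapDomain (PlaceOver.ofPrime K (RatFunc K)) PlaceOver.ofPrime_injective.injOn, ?_⟩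
  ext v
  rcases eq_ratFuncInftyPlace_or_exists_eq_ofPrime v with rfl | ⟨q, rfl⟩
  · rw [Finsupp.add_apply, Finsupp.single_eq_same, Finsupp.mapDomain_notin_range, add_zero]
    rintro ⟨q, hq⟩
    exact ofPrime_ne_ratFuncInftyPlace q hq
  · rw [Finsupp.add_apply, Finsupp.single_eq_of_ne (ofPrime_ne_ratFuncInftyPlace q),
      Finsupp.mapDomain_apply PlaceOver.ofPrime_injective, Finsupp.comapDomain_apply, zero_add]

/-- The coefficient of `P_∞` in `n • P_∞ + Σ_p E(p) • P_{p(x)}` is `n`. [folklore] -/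
theorem single_add_mapDomain_apply_ratFuncInftyPlace (n : ℤ)
    (E : HeightOneSpectrum K[X] →₀ ℤ) :
    (Finsupp.single (ratFuncInftyPlace K) n + E.mapDomain (PlaceOver.ofPrime K (RatFunc K)))
      (ratFuncInftyPlace K) = n := by
  rw [Finsupp.add_apply, Finsupp.single_eq_same, Finsupp.mapDomain_notin_range, add_zero]
  rintro ⟨q, hq⟩
  exact ofPrime_ne_ratFuncInftyPlace q hq

/-- The coefficient of `P_{p(x)}` in `n • P_∞ + Σ_p E(p) • P_{p(x)}` is `E(p)`. [folklore] -/
theorem single_add_mapDomain_apply_ofPrime (n : ℤ)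
    (E : HeightOneSpectrum K[X] →₀ ℤ) (q : HeightOneSpectrum K[X]) :
    (Finsupp.single (ratFuncInftyPlace K) n + E.mapDomain (PlaceOver.ofPrime K (RatFunc K)))
      (PlaceOver.ofPrime K (RatFunc K) q) = E q := by
  rw [Finsupp.add_apply, Finsupp.single_eq_of_ne (ofPrime_ne_ratFuncInftyPlace q),
    Finsupp.mapDomain_apply PlaceOver.ofPrime_injective, zero_add]

/-! ### Generators of the primes of `K[X]` and the multiplier of a divisor -/

/-- The (chosen) generator `p(x)` of a nonzero prime `(p(x)) ⊂ K[X]` is nonzero. [folklore] -/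
theorem generator_asIdeal_ne_zero (q : HeightOneSpectrum K[X]) : generator q.asIdeal ≠ 0 := by
  rw [Ne, ← Submodule.IsPrincipal.eq_bot_iff_generator_eq_zero]
  exact q.ne_bot

/-- `deg P_{p(x)} = deg p(x)` for the chosen generator (Stichtenoth Prop. 1.2.1 (a)).
[cite: Stichtenoth2009, Prop. 1.2.1(a)] -/
theorem degree_ofPrime_eq_natDegree_generator (q : HeightOneSpectrum K[X]) :
    (PlaceOver.ofPrime K (RatFunc K) q).degree = (generator q.asIdeal).natDegree :=
  degree_ofPrime_eq_natDegree q (Ideal.span_singleton_generator q.asIdeal).symm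

/-- `v_p(p(x)) = exp (-1)`: the generator is a uniformizer of the `p`-adic valuation (Mathlib
`intValuation_singleton`). [folklore] -/
theorem valuation_generator_self (q : HeightOneSpectrum K[X]) :
    q.valuation (RatFunc K) (algebraMap K[X] (RatFunc K) (generator q.asIdeal)) = exp (-1) := by
  rw [HeightOneSpectrum.valuation_of_algebraMap]
  exact HeightOneSpectrum.intValuation_singleton _ (generator_asIdeal_ne_zero q)
    (Ideal.span_singleton_generator q.asIdeal).symm

/-- `v_{p'}(p(x)) = 1` for a prime `p' ≠ p` (distinct nonzero primes of `K[X]` are comaximal).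
[folklore] -/
theorem valuation_generator_of_ne {q q' : HeightOneSpectrum K[X]} (h : q' ≠ q) :
    q'.valuation (RatFunc K) (algebraMap K[X] (RatFunc K) (generator q.asIdeal)) = 1 := by
  rw [HeightOneSpectrum.valuation_eq_one_iff_notMem]
  intro hmem
  apply h
  have hle : q.asIdeal ≤ q'.asIdeal := by
    rw [← Ideal.span_singleton_generator q.asIdeal, Ideal.span_le, Set.singleton_subset_iff]
    exact hmem
  exact HeightOneSpectrum.ext (q.isMaximal.eq_of_le q'.isPrime.ne_top hle).symm

/-- `v_∞(p(x)) = exp (deg p(x))` (Stichtenoth Prop. 1.2.1 (c): `v_∞(f/g) = deg g - deg f`;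
Mathlib's `inftyValuation` is written multiplicatively with the opposite sign convention
`inftyValuation (f/g) = exp (deg f - deg g)`). [folklore] -/
theorem inftyValuation_generator [DecidableEq (RatFunc K)] (q : HeightOneSpectrum K[X]) :
    RatFunc.inftyValuation K (algebraMap K[X] (RatFunc K) (generator q.asIdeal)) =
      exp ((generator q.asIdeal).natDegree : ℤ) := by
  rw [RatFunc.inftyValuation_apply,
    RatFunc.inftyValuation.polynomial _ (generator_asIdeal_ne_zero q)]

/-- `exp` turns finite sums into finite products (`ℤ → ℤᵐ⁰`). [folklore] -/
theorem exp_finset_sum {ι : Type*} (s : Finset ι) (c : ι → ℤ) :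
    exp (∑ i ∈ s, c i) = ∏ i ∈ s, exp (c i) := by
  classical
  induction s using Finset.induction_on with
  | empty => simp
  | insert a s ha ih => rw [Finset.sum_insert ha, Finset.prod_insert ha, exp_add, ih]

/-- The *multiplier* `f_E := ∏_p p(x)^{E(p)} ∈ K(X)` of a finite part `E` is nonzero.
[folklore] -/
theorem finsuppProd_generator_zpow_ne_zero (E : HeightOneSpectrum K[X] →₀ ℤ) :
    (E.prod fun q m ↦ algebraMap K[X] (RatFunc K) (generator q.asIdeal) ^ m) ≠ 0 := by
  rw [Finsupp.prod_ne_zero_iff]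
  intro q _
  exact zpow_ne_zero _ (RatFunc.algebraMap_ne_zero (generator_asIdeal_ne_zero q))

/-- `v_p(f_E) = exp (-E(p))` for the multiplier `f_E = ∏_p p(x)^{E(p)}` (Stichtenoth
Example 1.4.13, eq. (1.20): the principal divisor of `∏ p_i^{n_i}` is
`Σ n_i P_i - (deg) P_∞`). [cite: Stichtenoth2009, Example 1.4.13 (1.20)] -/
theorem valuation_finsuppProd_generator_zpow (E : HeightOneSpectrum K[X] →₀ ℤ)
    (q : HeightOneSpectrum K[X]) :
    q.valuation (RatFunc K)
        (E.prod fun q m ↦ algebraMap K[X] (RatFunc K) (generator q.asIdeal) ^ m) =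
      exp (-(E q)) := by
  rw [map_finsuppProd, Finsupp.prod, Finset.prod_eq_single q]
  · rw [map_zpow₀, valuation_generator_self, ← exp_zsmul, smul_eq_mul, mul_neg, mul_one]
  · intro b _ hb
    rw [map_zpow₀, valuation_generator_of_ne (Ne.symm hb), one_zpow]
  · intro hq
    rw [Finsupp.notMem_support_iff.1 hq, zpow_zero, map_one]

/-- `v_∞(f_E) = exp (Σ_p E(p) deg p(x))` for the multiplier `f_E = ∏_p p(x)^{E(p)}`
(Stichtenoth Example 1.4.13, eq. (1.20)). [cite: Stichtenoth2009, Example 1.4.13 (1.20)] -/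
theorem inftyValuation_finsuppProd_generator_zpow [DecidableEq (RatFunc K)]
    (E : HeightOneSpectrum K[X] →₀ ℤ) :
    RatFunc.inftyValuation K
        (E.prod fun q m ↦ algebraMap K[X] (RatFunc K) (generator q.asIdeal) ^ m) =
      exp (E.sum fun q m ↦ m * ((generator q.asIdeal).natDegree : ℤ)) := by
  rw [map_finsuppProd, Finsupp.prod, Finsupp.sum, exp_finset_sum]
  refine Finset.prod_congr rfl fun q _ ↦ ?_
  rw [map_zpow₀, inftyValuation_generator, ← exp_zsmul, smul_eq_mul]

/-! ### The Riemann–Roch spaces of `K(X)` -/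

/-- Membership in `L(n • P_∞ + Σ_p E(p) • P_{p(x)})` in terms of Mathlib's normalised
valuations of `K(X)`: `v_∞(x) ≤ exp n` and `v_p(x) ≤ exp E(p)` for all `p` (Stichtenoth
Def. 1.4.4 with Prop. 1.2.1 and Thm. 1.2.2).
[cite: Stichtenoth2009, Def. 1.4.4 with Prop. 1.2.1 and Thm. 1.2.2] -/
theorem mem_riemannRochSpace_single_add_mapDomain_iff [DecidableEq (RatFunc K)] (n : ℤ)
    (E : HeightOneSpectrum K[X] →₀ ℤ) (x : RatFunc K) :
    x ∈ riemannRochSpace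
        (Finsupp.single (ratFuncInftyPlace K) n + E.mapDomain (PlaceOver.ofPrime K (RatFunc K))) ↔
      RatFunc.inftyValuation K x ≤ exp n ∧
        ∀ q : HeightOneSpectrum K[X], q.valuation (RatFunc K) x ≤ exp (E q) := by
  rw [mem_riemannRochSpace_iff]
  constructor
  · intro h
    refine ⟨?_, fun q ↦ ?_⟩
    · have := h (ratFuncInftyPlace K)
      rwa [single_add_mapDomain_apply_ratFuncInftyPlace, valuation_ratFuncInftyPlace_le_iff] at this
    · have := h (PlaceOver.ofPrime K (RatFunc K) q)
      rwa [single_add_mapDomain_apply_ofPrime, PlaceOver.valuation_ofPrime_le_iff]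
        at this
  · rintro ⟨hinf, hfin⟩ v
    rcases eq_ratFuncInftyPlace_or_exists_eq_ofPrime v with rfl | ⟨q, rfl⟩
    · rwa [single_add_mapDomain_apply_ratFuncInftyPlace, valuation_ratFuncInftyPlace_le_iff]
    · rw [single_add_mapDomain_apply_ofPrime, PlaceOver.valuation_ofPrime_le_iff]
      exact hfin q

/-- **`L(D)` for the rational function field.** For `D = n • P_∞ + Σ_p E(p) • P_{p(x)}` with
multiplier `f = ∏_p p(x)^{E(p)}` and `d := deg D = n + Σ_p E(p) deg p(x)`:
`x ∈ L(D) ↔ f · x` is a polynomial of degree `≤ d` (the genus-zero case of Riemann–Roch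
made explicit: `L(D) = f⁻¹ · K[X]_{≤ d}`; cf. Stichtenoth Example 1.4.18, where
`1, x, …, x^r ∈ L(r P_∞)` is the case `E = 0`). Proof: `v_p(f x) ≤ 1` for all `p` iff
`f x ∈ K[X]` (Mathlib `IsDedekindDomain.HeightOneSpectrum.mem_integers_of_valuation_le_one`),
and then `v_∞(f x) = exp (deg (f x))`.
[cite: Stichtenoth2009, Example 1.4.18 and Example 1.4.13] -/
theorem mem_riemannRochSpace_single_add_mapDomain_iff_exists_polynomial (n : ℤ)
    (E : HeightOneSpectrum K[X] →₀ ℤ) (x : RatFunc K) :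
    x ∈ riemannRochSpace
        (Finsupp.single (ratFuncInftyPlace K) n + E.mapDomain (PlaceOver.ofPrime K (RatFunc K))) ↔
      ∃ p : K[X],
        (p = 0 ∨
            (p.natDegree : ℤ) ≤ n + E.sum fun q m ↦ m * ((generator q.asIdeal).natDegree : ℤ)) ∧
          (E.prod fun q m ↦ algebraMap K[X] (RatFunc K) (generator q.asIdeal) ^ m) * x =
            algebraMap K[X] (RatFunc K) p := by
  classical
  set f := E.prod fun q m ↦ algebraMap K[X] (RatFunc K) (generator q.asIdeal) ^ m with hfdef
  set S := E.sum fun q m ↦ m * ((generator q.asIdeal).natDegree : ℤ) with hSdef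
  have hf : f ≠ 0 := finsuppProd_generator_zpow_ne_zero E
  have hfq : ∀ q : HeightOneSpectrum K[X], q.valuation (RatFunc K) f = exp (-(E q)) :=
    valuation_finsuppProd_generator_zpow E
  have hfinf : RatFunc.inftyValuation K f = exp S := inftyValuation_finsuppProd_generator_zpow E
  rw [mem_riemannRochSpace_single_add_mapDomain_iff]
  constructor
  · rintro ⟨hinf, hfin⟩
    have hint : ∀ q : HeightOneSpectrum K[X], q.valuation (RatFunc K) (f * x) ≤ 1 := by
      intro q
      rw [map_mul, hfq]
      calc exp (-(E q)) * q.valuation (RatFunc K) x ≤ exp (-(E q)) * exp (E q) :=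
            mul_le_mul_right (hfin q) _
        _ = 1 := by rw [← exp_add, neg_add_cancel, exp_zero]
    obtain ⟨p, hp⟩ :=
      HeightOneSpectrum.mem_integers_of_valuation_le_one (RatFunc K) (f * x) hint
    refine ⟨p, ?_, hp.symm⟩
    by_cases hp0 : p = 0
    · exact Or.inl hp0
    · right
      have h1 : RatFunc.inftyValuation K (f * x) ≤ exp (S + n) := by
        rw [map_mul, hfinf, exp_add]
        exact mul_le_mul_right hinf _
      rw [← hp, RatFunc.inftyValuation_apply, RatFunc.inftyValuation.polynomial _ hp0,
        exp_le_exp] at h1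
      omega
  · rintro ⟨p, hp, hpx⟩
    have hx : x = f⁻¹ * algebraMap K[X] (RatFunc K) p := by
      rw [← hpx, inv_mul_cancel_left₀ hf]
    by_cases hp0 : p = 0
    · simp [hx, hp0]
    have hdeg : (p.natDegree : ℤ) ≤ n + S := hp.resolve_left hp0
    refine ⟨?_, fun q ↦ ?_⟩
    · rw [hx, map_mul, map_inv₀, hfinf, RatFunc.inftyValuation_apply,
        RatFunc.inftyValuation.polynomial _ hp0, ← exp_neg, ← exp_add, exp_le_exp]
      omega
    · rw [hx, map_mul, map_inv₀, hfq, ← exp_neg, neg_neg]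
      exact mul_le_of_le_one_right' (HeightOneSpectrum.valuation_le_one q p)

/-- The degree of `n • P_∞ + Σ_p E(p) • P_{p(x)}` is `n + Σ_p E(p) deg p(x)`
(`deg P_∞ = 1`, `deg P_{p(x)} = deg p(x)`, Stichtenoth Prop. 1.2.1).
[cite: Stichtenoth2009, Prop. 1.2.1] -/
theorem degree_single_add_mapDomain (n : ℤ) (E : HeightOneSpectrum K[X] →₀ ℤ) :
    Divisor.degree
        (Finsupp.single (ratFuncInftyPlace K) n + E.mapDomain (PlaceOver.ofPrime K (RatFunc K))) =
      n + E.sum fun q m ↦ m * ((generator q.asIdeal).natDegree : ℤ) := by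
  rw [map_add, Divisor.degree_single, degree_ratFuncInftyPlace, Nat.cast_one, mul_one,
    Divisor.degree_apply, Finsupp.sum_mapDomain_index_inj PlaceOver.ofPrime_injective]
  simp only [degree_ofPrime_eq_natDegree_generator]

/-- **Dimension of `L(D)` for `K(X)`.** For `D = n • P_∞ + Σ_p E(p) • P_{p(x)}` of degree
`d = n + Σ_p E(p) deg p(x)`: `ℓ(D) = max (0, d + 1)`, because `p ↦ f⁻¹ p` is a `K`-linear
isomorphism from the polynomials of degree `≤ d` onto `L(D)`
(`mem_riemannRochSpace_single_add_mapDomain_iff_exists_polynomial`). This is Riemann–Roch in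
genus `0` (Stichtenoth Thm. 1.5.17 with Example 1.4.18, and Cor. 1.4.12 (b) for `d < 0`), proved
here directly. [cite: Stichtenoth2009, Example 1.4.18, Thm. 1.5.17 and Cor. 1.4.12(b)] -/
theorem ell_single_add_mapDomain (n : ℤ) (E : HeightOneSpectrum K[X] →₀ ℤ) :
    ell (Finsupp.single (ratFuncInftyPlace K) n + E.mapDomain (PlaceOver.ofPrime K (RatFunc K))) =
      (n + (E.sum fun q m ↦ m * ((generator q.asIdeal).natDegree : ℤ)) + 1).toNat := by
  set f := E.prod fun q m ↦ algebraMap K[X] (RatFunc K) (generator q.asIdeal) ^ m with hfdef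
  set d := n + E.sum fun q m ↦ m * ((generator q.asIdeal).natDegree : ℤ) with hddef
  have hf : f ≠ 0 := finsuppProd_generator_zpow_ne_zero E
  -- the polynomials of degree `≤ d`
  have hmem : ∀ p : K[X],
      p ∈ degreeLT K (d + 1).toNat ↔ p = 0 ∨ (p.natDegree : ℤ) ≤ d := by
    intro p
    rw [mem_degreeLT]
    by_cases hp0 : p = 0
    · simp [hp0]
    · rw [degree_eq_natDegree hp0, Nat.cast_lt, Int.lt_toNat, or_iff_right hp0]
      constructor <;> intro h <;> omega
  -- `p ↦ f⁻¹ p`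
  let φ : degreeLT K (d + 1).toNat →ₗ[K] RatFunc K :=
    (LinearMap.mulLeft K f⁻¹).comp
      ((IsScalarTower.toAlgHom K K[X] (RatFunc K)).toLinearMap.comp
        (degreeLT K (d + 1).toNat).subtype)
  have hφ : ∀ p, φ p = f⁻¹ * algebraMap K[X] (RatFunc K) p := fun p ↦ rfl
  have hinj : Function.Injective φ := by
    intro a b h
    rw [hφ, hφ, mul_right_inj' (inv_ne_zero hf)] at h
    exact Subtype.ext (RatFunc.algebraMap_injective K h)
  have hrange : LinearMap.range φ = riemannRochSpace
      (Finsupp.single (ratFuncInftyPlace K) n + E.mapDomain (PlaceOver.ofPrime K (RatFunc K))) := by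
    ext x
    rw [LinearMap.mem_range, mem_riemannRochSpace_single_add_mapDomain_iff_exists_polynomial]
    constructor
    · rintro ⟨p, rfl⟩
      exact ⟨p, (hmem p).1 p.2, by rw [hφ, mul_inv_cancel_left₀ hf]⟩
    · rintro ⟨p, hp, hpx⟩
      exact ⟨⟨p, (hmem p).2 hp⟩, by rw [hφ, ← hpx, inv_mul_cancel_left₀ hf]⟩
  rw [ell, ← hrange, LinearMap.finrank_range_of_inj hinj,
    (degreeLTEquiv K (d + 1).toNat).finrank_eq, Module.finrank_fin_fun]

/-- **Riemann–Roch for `K(X)`**: `ℓ(D) = max (0, deg D + 1)` for every divisor `D` of the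
rational function field (genus `0`: Stichtenoth Example 1.4.18 with Thm. 1.5.17 for
`deg D ≥ -1` and Cor. 1.4.12 (b) for `deg D < 0`; proved here directly from
`L(D) = f⁻¹ · K[X]_{≤ deg D}`).
[cite: Stichtenoth2009, Example 1.4.18, Thm. 1.5.17 and Cor. 1.4.12(b)] -/
theorem ell_ratFunc (D : Divisor K (RatFunc K)) : ell D = (D.degree + 1).toNat := by
  obtain ⟨n, E, rfl⟩ := Divisor.exists_eq_single_add_mapDomain D
  rw [ell_single_add_mapDomain, degree_single_add_mapDomain]

/-- For `K(X)/K` the set `{deg D + 1 - ℓ(D)} ∩ ℕ` of Stichtenoth's Def. 1.4.15 is `{0}`: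
`deg D + 1 - ℓ(D) = deg D + 1 - max (0, deg D + 1) ≤ 0`, with equality at `D = 0`.
[cite: Stichtenoth2009, Example 1.4.18] -/
theorem genusSet_ratFunc (K : Type u) [Field K] : genusSet K (RatFunc K) = {0} := by
  ext g
  simp only [genusSet, Set.mem_setOf_eq, Set.mem_singleton_iff, ell_ratFunc]
  constructor
  · rintro ⟨D, hD⟩
    have := Int.self_le_toNat (D.degree + 1)
    omega
  · rintro rfl
    exact ⟨0, by simp⟩

/-- **Discharge of `genus_ratFunc`** (Stichtenoth Example 1.4.18): the rational function field
`K(X)/K` has genus `g = max {deg D - ℓ(D) + 1} = 0`, for every field `K`. Stichtenoth derives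
`g ≤ 0` from Riemann's theorem (`ℓ(r P_∞) = r + 1 - g` for `r ≫ 0`, Thm. 1.4.17 (b)) and
`1, x, …, x^r ∈ L(r P_∞)`; since Riemann's theorem is only a named fact in
`FunctionFieldGenus`, we instead compute `ℓ(D) = max (0, deg D + 1)` for *every* divisor
(`ell_ratFunc`), using the list of places of `K(X)` (Thm. 1.2.2, `RatFuncPlaces`), which gives
`genusSet K K(X) = {0}`. [cite: Stichtenoth2009, Example 1.4.18] -/
theorem genus_ratFunc_holds : genus_ratFunc := by
  intro K _
  rw [genus, genusSet_ratFunc, csSup_singleton]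

end RatFuncRiemannRoch


end Literature.NumberTheory.DiophantineGeometry.AlgFunctionField
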